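import Summits.BirchSwinnertonDyer.BirchSwinnertonDyer.Theses.LeadingTerm
import Summits.BirchSwinnertonDyer.BirchSwinnertonDyer.Theses.PAdicOrderV2
import Summits.BirchSwinnertonDyer.BirchSwinnertonDyer.Theses.PAdicOrder
import Summits.BirchSwinnertonDyer.BirchSwinnertonDyer.Theses.SelmerRank
import Summits.BirchSwinnertonDyer.BirchSwinnertonDyer.Theorems.PAdicOrderV2PAdicOrderThesisR2StubResidualSectorsItems
import Summits.BirchSwinnertonDyer.BirchSwinnertonDyer.Theorems.LeadingTermPinchPrimeOpenStubsOfResidual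
import Literature.NumberTheory.EllipticCurves.KatoRankBoundProofs
import Literature.NumberTheory.EllipticCurves.SelmerInftyTorsionFiniteProofs

/-!
# Crux `PinchPrime` (stmt-BirchSwinnertonDyer-16218) — the ITEM-LEVEL HOMES of its two child items
# `SchneiderInfinitelyOftenOfPosRank` (S′, stmt-BirchSwinnertonDyer-17975) and
# `ShaFiniteCofiniteOfTwoLeAnalyticRank` (A′, stmt-BirchSwinnertonDyer-17976)

Helper file (line `SketchIdeator2`, lead c6, line cycle 7). Since 2026-08-17T09:37Z the two OPEN
registered stubs of the crux's only line are route items of `LeadingTerm` (crux-strategist s1):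

* S′ (stmt-17975): every elliptic `E/ℚ` (globally minimal `W`) of Mordell–Weil rank `≥ 1` that is
  not CM of rank `1` has, outside any finite set, a good ordinary `p ≥ 5` at which every canonical
  cyclotomic `p`-adic height datum is non-degenerate (`Reg_p(E) ≠ 0`);
* A′ (stmt-17976): every `E/ℚ` of analytic rank `≥ 2` has `Ш(E/ℚ)[p^∞]` finite for all good
  ordinary `p` outside a finite set.

This file records, sorry-free and with the items' statements VERBATIM as conclusions, which
EXISTING items of the summit's other routes already imply them — the dedup edges a planner needs
before staffing the children (the strategist's census recorded only A′ ⟸ `SelmerRankShaPFinite`):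

* `leadingTermChildSchneider_of_schneiderR8` — S′ ⟸ `PAdicOrder.PAdicOrderSchneiderR8`
  (stmt-BirchSwinnertonDyer-0536: Schneider's conjecture proper, every canonical datum at every good
  ordinary `p ≥ 5`), fact-free; the witness prime is any good ordinary `p ≥ 5` outside `B`
  (`exists_goodOrdinary_five_le_not_mem`, landed G11 helper);
* `leadingTermChildSha_of_shaPFiniteR2` — A′ ⟸ `SelmerRank.SelmerRankShaPFiniteR2`
  (stmt-BirchSwinnertonDyer-0133, the live successor of 0132: `Ш(E/ℚ)[p^∞]` finite for every
  elliptic `W` and every `p`), fact-free, `B = ∅`;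
* `leadingTermChildSha_of_padicBSDrank_katoCorankBound` — A′ (indeed `Ш[p^∞]` finite at EVERY
  good ordinary `p ≥ 5`, every curve, no analytic-rank hypothesis) ⟸ the sibling route's crux
  `PAdicOrderV2.PAdicOrderPadicBSDrankR2` (stmt-BirchSwinnertonDyer-0490: `ord_T L_p = r_MW` at
  every good ordinary prime and every newform) together with this route's support
  `LeadingTerm.KatoCorankBound` (stmt-BirchSwinnertonDyer-18048, Kato 2004 Thm. 18.4 in corank
  form), modulo modularity only: `corank Sel_{p^∞} ≤ ord_T L_p = r_MW ≤ corank Sel_{p^∞}` (Kummer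
  identity `selmerCorank_eq_mordellWeilRank_add_holds`), so `corank Ш[p^∞] = 0`, and a
  `p`-primary torsion group of corank `0` with finite `p`-torsion is finite
  (`finite_primaryComponent_sha_iff_shaCorank_eq_zero`);
* `leadingTermChildren_of_padicBSDrank_katoDivisibility` — BOTH children (indeed the same-prime
  pair at EVERY good ordinary `p ≥ 5` of every curve) ⟸ `PAdicOrderV2.PAdicOrderPadicBSDrankR2`
  (stmt-0490) ∧ `LeadingTerm.KatoDivisibility` (stmt-BirchSwinnertonDyer-18082, Kato 2004
  Thm. 17.4 (1)–(2), a theorem in print), modulo modularity `exists_isNewformOf` and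
  Perrin-Riou–Schneider `Schneider1985_order_charGenerator` (two of the five theorem-grade facts of
  the line's facts stub), through the sibling route's landed pointwise converter
  `LambdaAdicGZ.schneiderSha_of_orderEqRank_katoDivisibility` (`r_MW ≤ ord f_E ≤ ord L_p = r_MW`,
  then PRS clause 2);
* `leadingTermPinchPrime_of_padicBSDrank` — for comparison, the parent itself ⟸ stmt-0490 modulo
  modularity alone (the `∀ p` form trivially gives the `∃ p` form; the canonical datum exists by
  `exists_isCanonical_holds`, the prime by `exists_goodOrdinary_five_le_not_mem`).

So: closing stmt-0536 closes S′; closing stmt-0133 (or 0490 ∧ 18048 with modularity) closes A′;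
closing stmt-0490 ∧ stmt-18082 (with modularity and PRS) closes both children and — through the
landed G14 `stub_pinchPrime_of_children` / directly — the parent. Nothing is asserted
unconditionally; every hypothesis is a route item or a published theorem stated as a named fact.

References: Kato, Astérisque 295 (2004), Thm. 17.4, Thm. 18.4; Balakrishnan–Müller–Stein,
Math. Comp. 85 (2016), Thm. 1.7; Mazur–Stein–Tate 2006, Conj. 1.1; Greenberg LNM 1716 Thm. 1.2.
-/

noncomputable section

-- D-0017: single-problem summit, so `Summit.BirchSwinnertonDyer.BirchSwinnertonDyer.…` repeats a
-- namespace BY DESIGN.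
set_option linter.dupNamespace false

namespace Summit.BirchSwinnertonDyer.BirchSwinnertonDyer.Theorems

open scoped MatrixGroups ModularForm
open CongruenceSubgroup Literature.NumberTheory.EllipticCurves
  Literature.NumberTheory.EllipticCurves.ModularForms
open Summit.BirchSwinnertonDyer.BirchSwinnertonDyer.Theses
open Summit.BirchSwinnertonDyer.BirchSwinnertonDyer.Cruxes.PinchPrime.FirstLayerStability
open Summit.BirchSwinnertonDyer.BirchSwinnertonDyer.Cruxes.PAdicOrderThesisR2.LambdaAdicGZ

/-! ## S′ from Schneider's conjecture proper (item stmt-0536) -/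

/-- **Child S′ `SchneiderInfinitelyOftenOfPosRank` (stmt-BirchSwinnertonDyer-17975) from the item
`PAdicOrder.PAdicOrderSchneiderR8`** (stmt-BirchSwinnertonDyer-0536: every canonical cyclotomic
`p`-adic height datum is non-degenerate at every good ordinary `p ≥ 5`), fact-free: outside any
finite `B` there is a good ordinary `p ≥ 5` (`exists_goodOrdinary_five_le_not_mem`), and Schneider
proper applies there. The rank hypotheses of S′ are not used. [cite: MazurSteinTate2006, Conj. 1.1] -/
theorem leadingTermChildSchneider_of_schneiderR8 (hSch : PAdicOrder.PAdicOrderSchneiderR8) :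
    ∀ (W : WeierstrassCurve ℚ) [W.IsElliptic] [W.IsGloballyMinimal], 1 ≤ W.mordellWeilRank →
      (W.HasCM → 2 ≤ W.mordellWeilRank) → ∀ B : Finset ℕ,
        ∃ p ∉ B, ∃ _ : Fact p.Prime, 5 ≤ p ∧ IsOrdinaryAt W p ∧
          ∀ Dh : WeierstrassCurve.PAdicHeightData W p, Dh.IsCanonical →
            WeierstrassCurve.SchneiderConjecture Dh := by
  intro W _ _ _ _ B
  obtain ⟨p, hpB, hp, h5, hord⟩ := exists_goodOrdinary_five_le_not_mem W B
  exact ⟨p, hpB, hp, h5, hord, fun Dh hDh ↦ hSch W p h5 hord.1 hord.2 Dh hDh⟩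

/-! ## A′ from `Ш[p^∞]`-finiteness for all `(W, p)` (item stmt-0133) -/

/-- **Child A′ `ShaFiniteCofiniteOfTwoLeAnalyticRank` (stmt-BirchSwinnertonDyer-17976) from the
item `SelmerRank.SelmerRankShaPFiniteR2`** (stmt-BirchSwinnertonDyer-0133: `Ш(E/ℚ)[p^∞]` finite for
every elliptic `W/ℚ` and every prime `p`), fact-free, with the empty exceptional set. (The same from
the superseded twin `SelmerRankShaPFinite`, stated inline, is
`leadingTermPinchPrime_childSha_of_shaPFinite`.) [cite: Tate1974, Conj. 1] -/
theorem leadingTermChildSha_of_shaPFiniteR2 (h : SelmerRank.SelmerRankShaPFiniteR2) :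
    ∀ (W : WeierstrassCurve ℚ) [W.IsElliptic] [W.IsGloballyMinimal], 2 ≤ W.analyticRank →
      ∃ B : Finset ℕ, ∀ p ∉ B, ∀ [Fact p.Prime], IsOrdinaryAt W p →
        Finite (AddCommGroup.primaryComponent W.sha p) :=
  fun W _ _ _ ↦ ⟨∅, fun p _ _ _ ↦ h W p⟩

/-! ## A′ from the sibling crux `ord_T L_p = r_MW ∀ p` (stmt-0490) and Kato's corank bound (stmt-18048) -/

/-- **`Ш(E/ℚ)[p^∞]` is finite at every good ordinary `p ≥ 5` of every curve, from
`PAdicOrderV2.PAdicOrderPadicBSDrankR2` (stmt-0490) and `LeadingTerm.KatoCorankBound` (stmt-18048),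
modulo modularity** (for the newform the items quantify over): at such `p`,
`corank Sel_{p^∞} ≤ ord_T L_p = r_MW` (the two items) and `corank Sel_{p^∞} = r_MW + corank Ш[p^∞]`
(`selmerCorank_eq_mordellWeilRank_add_holds`), so `corank Ш[p^∞] = 0`, i.e. `Ш[p^∞]` is finite
(`finite_primaryComponent_sha_iff_shaCorank_eq_zero`). No PRS, no height, no analytic rank.
[cite: Kato2004, Thm 18.4] -/
theorem shaFinite_of_padicBSDrank_katoCorankBound (hmod : exists_isNewformOf)
    (h3 : PAdicOrderV2.PAdicOrderPadicBSDrankR2) (hK : LeadingTerm.KatoCorankBound)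
    (W : WeierstrassCurve ℚ) [W.IsElliptic] [W.IsGloballyMinimal] (p : ℕ) [Fact p.Prime]
    (h5 : 5 ≤ p) (hord : IsOrdinaryAt W p) :
    W.selmerCorank p = W.mordellWeilRank ∧ Finite (AddCommGroup.primaryComponent W.sha p) := by
  haveI : NeZero (W.conductorNorm ℤ) := ⟨(WeierstrassCurve.conductorNorm_pos_holds (W := W)).ne'⟩
  obtain ⟨f, hf⟩ := hmod W
  have hk := hK W p (by omega) hord f hf
  rw [h3 W p hord f hf] at hk
  have h1 : W.selmerCorank p ≤ W.mordellWeilRank := by exact_mod_cast hk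
  have h2 := W.selmerCorank_eq_mordellWeilRank_add_holds p
  have hsha : W.shaCorank p = 0 := by omega
  exact ⟨by omega, (finite_primaryComponent_sha_iff_shaCorank_eq_zero W p).mpr hsha⟩

/-- **Child A′ (stmt-BirchSwinnertonDyer-17976) from `PAdicOrderV2.PAdicOrderPadicBSDrankR2`
(stmt-0490) and `LeadingTerm.KatoCorankBound` (stmt-18048), modulo modularity**, with the
exceptional set `{0, 1, 2, 3, 4}` (the analytic-rank hypothesis is not used).
[cite: Kato2004, Thm 18.4] -/
theorem leadingTermChildSha_of_padicBSDrank_katoCorankBound (hmod : exists_isNewformOf)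
    (h3 : PAdicOrderV2.PAdicOrderPadicBSDrankR2) (hK : LeadingTerm.KatoCorankBound) :
    ∀ (W : WeierstrassCurve ℚ) [W.IsElliptic] [W.IsGloballyMinimal], 2 ≤ W.analyticRank →
      ∃ B : Finset ℕ, ∀ p ∉ B, ∀ [Fact p.Prime], IsOrdinaryAt W p →
        Finite (AddCommGroup.primaryComponent W.sha p) := by
  intro W _ _ _
  refine ⟨Finset.range 5, fun p hpB _ hord ↦ ?_⟩
  have h5 : 5 ≤ p := by
    by_contra h
    exact hpB (Finset.mem_range.mpr (by omega))
  exact (shaFinite_of_padicBSDrank_katoCorankBound hmod h3 hK W p h5 hord).2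

/-! ## Both children from the sibling crux (stmt-0490) and Kato's divisibility (stmt-18082) -/

/-- **The same-prime pair at EVERY good ordinary `p ≥ 5` of every curve, from
`PAdicOrderV2.PAdicOrderPadicBSDrankR2` (stmt-0490) and `LeadingTerm.KatoDivisibility` (stmt-18082),
modulo modularity and Perrin-Riou–Schneider** (hypotheses, published theorems): `Ш(E/ℚ)[p^∞]` is
finite and every canonical cyclotomic height datum is non-degenerate. The converter is the sibling
route's landed `schneiderSha_of_orderEqRank_katoDivisibility` (Kato in the item's two-clause shape:
`r_MW ≤ ord f_E ≤ ord L_p = r_MW`, then PRS clause 2); `LeadingTerm.KatoDivisibility` and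
`PAdicOrderV2.KatoDivisibility` are the same item stmt-18082 with the same body.
[cite: BalakrishnanMullerStein2015, Thm. 1.7] [cite: Kato2004Asterisque, Thm. 17.4 (p. 273)] -/
theorem schneiderSha_everywhere_of_padicBSDrank_katoDivisibility (hmod : exists_isNewformOf)
    (hPRS : Schneider1985_order_charGenerator) (h3 : PAdicOrderV2.PAdicOrderPadicBSDrankR2)
    (hK : LeadingTerm.KatoDivisibility)
    (W : WeierstrassCurve ℚ) [W.IsElliptic] [W.IsGloballyMinimal] (p : ℕ) [Fact p.Prime]
    (h5 : 5 ≤ p) (hord : IsOrdinaryAt W p) :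
    Finite (AddCommGroup.primaryComponent W.sha p) ∧
      ∀ Dh : WeierstrassCurve.PAdicHeightData W p, Dh.IsCanonical →
        WeierstrassCurve.SchneiderConjecture Dh := by
  haveI : NeZero (W.conductorNorm ℤ) := ⟨(WeierstrassCurve.conductorNorm_pos_holds (W := W)).ne'⟩
  obtain ⟨f, hf⟩ := hmod W
  have hK' : PAdicOrderV2.KatoDivisibility :=
    (Iff.rfl : LeadingTerm.KatoDivisibility ↔ PAdicOrderV2.KatoDivisibility).mp hK
  exact schneiderSha_of_orderEqRank_katoDivisibility hPRS hK' W p f h5 hord hf (h3 W p hord f hf)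

/-- **Both child items of the crux, verbatim, from `PAdicOrderV2.PAdicOrderPadicBSDrankR2`
(stmt-0490) and `LeadingTerm.KatoDivisibility` (stmt-18082), modulo modularity and
Perrin-Riou–Schneider**: A′ with the exceptional set `{0, …, 4}` and S′ at any good ordinary
`p ≥ 5` outside `B`. The rank / analytic-rank / CM hypotheses of the children are not used — the
`∀ p` sibling crux is that much stronger than what the parent needs.
[cite: BalakrishnanMullerStein2015, Thm. 1.7] [cite: Kato2004Asterisque, Thm. 17.4 (p. 273)]
[cite: MazurSteinTate2006, Conj. 1.1] -/
theorem leadingTermChildren_of_padicBSDrank_katoDivisibility (hmod : exists_isNewformOf)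
    (hPRS : Schneider1985_order_charGenerator) (h3 : PAdicOrderV2.PAdicOrderPadicBSDrankR2)
    (hK : LeadingTerm.KatoDivisibility) :
    (∀ (W : WeierstrassCurve ℚ) [W.IsElliptic] [W.IsGloballyMinimal], 2 ≤ W.analyticRank →
      ∃ B : Finset ℕ, ∀ p ∉ B, ∀ [Fact p.Prime], IsOrdinaryAt W p →
        Finite (AddCommGroup.primaryComponent W.sha p)) ∧
    (∀ (W : WeierstrassCurve ℚ) [W.IsElliptic] [W.IsGloballyMinimal], 1 ≤ W.mordellWeilRank →
      (W.HasCM → 2 ≤ W.mordellWeilRank) → ∀ B : Finset ℕ,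
        ∃ p ∉ B, ∃ _ : Fact p.Prime, 5 ≤ p ∧ IsOrdinaryAt W p ∧
          ∀ Dh : WeierstrassCurve.PAdicHeightData W p, Dh.IsCanonical →
            WeierstrassCurve.SchneiderConjecture Dh) := by
  refine ⟨fun W _ _ _ ↦ ⟨Finset.range 5, fun p hpB _ hord ↦ ?_⟩, fun W _ _ _ _ B ↦ ?_⟩
  · have h5 : 5 ≤ p := by
      by_contra h
      exact hpB (Finset.mem_range.mpr (by omega))
    exact (schneiderSha_everywhere_of_padicBSDrank_katoDivisibility hmod hPRS h3 hK W p h5 hord).1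
  · obtain ⟨p, hpB, hp, h5, hord⟩ := exists_goodOrdinary_five_le_not_mem W B
    exact ⟨p, hpB, hp, h5, hord,
      (schneiderSha_everywhere_of_padicBSDrank_katoDivisibility hmod hPRS h3 hK W p h5 hord).2⟩

/-! ## For comparison: the parent from the sibling crux directly -/

/-- **`LeadingTerm.PinchPrime` from `PAdicOrderV2.PAdicOrderPadicBSDrankR2` (stmt-0490) modulo
modularity alone**: the `∀ p` form gives the `∃ p` form at any good ordinary `p ≥ 5`
(`exists_goodOrdinary_five_le_not_mem`), with the canonical datum of `exists_isCanonical_holds` and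
the newform of modularity. (So the route through the children costs Kato + PRS on top of what the
sibling crux gives directly — the price of splitting `∃ p` into cofinite × infinitely-often.)
[cite: MazurSteinTate2006, §1] -/
theorem leadingTermPinchPrime_of_padicBSDrank (hmod : exists_isNewformOf)
    (h3 : PAdicOrderV2.PAdicOrderPadicBSDrankR2) : LeadingTerm.PinchPrime := by
  intro W _ _
  haveI : NeZero (W.conductorNorm ℤ) := ⟨(WeierstrassCurve.conductorNorm_pos_holds (W := W)).ne'⟩
  obtain ⟨f, hf⟩ := hmod W
  obtain ⟨p, -, hp, h5, hord⟩ := exists_goodOrdinary_five_le_not_mem W ∅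
  obtain ⟨D, hD⟩ := WeierstrassCurve.exists_isCanonical_holds W p h5 hord.1 hord.2
  exact ⟨p, hp, h5, hord, D, hD, W.conductorNorm ℤ, inferInstance, f, hf, h3 W p hord f hf⟩

end Summit.BirchSwinnertonDyer.BirchSwinnertonDyer.Theorems

end
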